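import Summits.ABC.IUTFork.Joshi.HolomorphoidsOfDeformation
import Summits.ABC.IUTFork.Joshi.ArithmeticoidsToyModel
import HarnessLib

/-!
# A TOY MODEL of the [J-III] §2 signature (`ATS3.ArithFFDatum`, `NormalizedArithmeticoid`, `GlobalHolomorphoid`) — joint satisfiability, and the toy's verdict on the one claim-`Prop` of §2.1–§2.3

Block E support file (cell abc-iut, rung LADDER-ABC:A2.E; seat abc-iut-E-t5, slot T-05). The object files
`Joshi/Holomorphoids.lean` (p431320) and `Joshi/HolomorphoidsSchemesElliptic.lean` type K. Joshi's [J-III] = arXiv:2401.13508v4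
§2 over HYPOTHESIS structures — `ArithFFDatum L` (the adelic Fargues–Fontaine / arithmeticoid signature), its
`NormalizedArithmeticoid` (carrying the product formula (2.1.1) as a field) and `GlobalHolomorphoid G` over an
`AnalyticSignature`. If those fields were jointly UNSATISFIABLE every statement quantifying over them would be vacuous
(CONVENTIONS §4). This file certifies they are not, at floor level, by TRANSPORTING E-t37's one-place toy model of
`ATS2h.DeformationDatum` (`ArithmeticoidsToyModel`, p432522: `L = ℚ`, one place, `L_v = K_y = ℚ(X)` with the degree
absolute value, one point) along the merge map `ArithFFDatum.ofDeformation` (`HolomorphoidsOfDeformation`):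
* `toy_triangleValued` — the degree absolute value is subadditive (it is ultrametric), so the merge map applies;
* `toyArithFF : ArithFFDatum ℚ`, `toyNormalized` (its normalized arithmeticoid — the product formula (2.1.1) holds there by
  `NormalizedArithmeticoid.ofDeformation`, i.e. DERIVED, not postulated), `toyAnalytic` (every category the one-object
  discrete category), `toyHolomorphoid : GlobalHolomorphoid toyAnalytic` — hence `Nonempty` for each signature;
* the toy's verdict: `ArithFFDatum.ExistTopInequivalentArithmeticoids` ([J-III] Thm. 2.3.1's ground, [J2h] Thm. 5.5.2 (7))
  FAILS in the toy (`not_toy_existTopInequivalent`, from E-t37's `not_toy_thm552_7` through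
  `existTopInequivalent_ofDeformation_iff`) — so it is CONTENTFUL (not a consequence of the signature), as a claim should be.
DEGENERATE by design; nothing here is a statement about Joshi's mathematics, number fields or [IUTchIII]; typed ≠ proved;
no side taken. The model is [folklore]; [claim: Joshi2024ATS3, status: disputed] applies to the quoted claim-`Prop` only.
-/

noncomputable section

namespace Summit.ABC.IUTFork.Joshi.ATS3

open CategoryTheory ATS2h

/-- The toy's degree absolute value on `ℚ(X)` is subadditive (indeed ultrametric: `deg(a+b) ≤ max(deg a, deg b)`).
[folklore] -/
theorem toy_degAbs_add_le (a b : RatFunc ℚ) : Toy.degAbs (a + b) ≤ Toy.degAbs a + Toy.degAbs b := by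
  have hn : ∀ r, 0 ≤ Toy.degAbs r := Toy.degAbs_isValuedField.nonneg
  by_cases hab : a + b = 0
  · rw [hab, Toy.degAbs_zero]; exact add_nonneg (hn a) (hn b)
  by_cases ha : a = 0
  · simp [ha]
  by_cases hb : b = 0
  · simp [hb]
  rw [Toy.degAbs_of_ne_zero hab, Toy.degAbs_of_ne_zero ha, Toy.degAbs_of_ne_zero hb]
  rcases le_max_iff.1 (RatFunc.intDegree_add_le hb hab) with h | h
  · exact le_add_of_le_of_nonneg (zpow_le_zpow_right₀ (by norm_num) h) (by positivity)
  · exact le_add_of_nonneg_of_le (by positivity) (zpow_le_zpow_right₀ (by norm_num) h)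

/-- The merge map's hypothesis holds for the toy: every residue-field valuation of `toyDatum` is subadditive. [folklore] -/
theorem toy_triangleValued : TriangleValued toyDatum := fun _ _ a b => toy_degAbs_add_le a b

/-- **The toy `ArithFFDatum` over `ℚ`** (one place, `L_v = K_y = ℚ(X)`, one point, tilt carriers `PUnit`): E-t37's toy
deformation datum transported along `ArithFFDatum.ofDeformation`. [folklore] -/
def toyArithFF : ArithFFDatum ℚ := ArithFFDatum.ofDeformation toyDatum toy_triangleValued

/-- The signature `ArithFFDatum` is inhabited. [folklore] -/
theorem arithFFDatum_nonempty : Nonempty (ArithFFDatum ℚ) := ⟨toyArithFF⟩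

/-- **The toy normalized arithmeticoid** (its only point; `α = 1`; the product formula (2.1.1) DERIVED from E-t37's
(5.3.4) by `NormalizedArithmeticoid.ofDeformation`). [folklore] -/
def toyNormalized : toyArithFF.NormalizedArithmeticoid :=
  NormalizedArithmeticoid.ofDeformation toyDatum toy_triangleValued fun _ => ()

/-- The hypothesis structure `NormalizedArithmeticoid` (with its product-formula and finite-support fields) is inhabited.
[folklore] -/
theorem normalizedArithmeticoid_nonempty : Nonempty toyArithFF.NormalizedArithmeticoid := ⟨toyNormalized⟩

/-- THE TOY'S VERDICT on [J-III] Thm. 2.3.1's ground as typed (`ExistTopInequivalentArithmeticoids`, «topologically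
inequivalent arithmeticoids exist», [J2h] Thm. 5.5.2 (7)): it FAILS in the toy (one point; E-t37's `not_toy_thm552_7` through
the definitional agreement `existTopInequivalent_ofDeformation_iff`) — so the claim is NOT a consequence of the signature:
contentful. [claim: Joshi2024ATS3, status: disputed] -/
theorem not_toy_existTopInequivalent : ¬ toyArithFF.ExistTopInequivalentArithmeticoids :=
  fun h => not_toy_thm552_7 ((existTopInequivalent_ofDeformation_iff toyDatum toy_triangleValued).1 h)

/-- **The toy analytic signature** over `toyArithFF`: schemes and analytic spaces are the one-object discrete category,
analytification and base change the identity functor, the base-change transformation the identity, every spectrum the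
object. [folklore] -/
def toyAnalytic : AnalyticSignature toyArithFF (Discrete PUnit) (fun _ => Discrete PUnit) where
  an _ := 𝟭 _
  anK _ _ := 𝟭 _
  bc _ _ := 𝟙 _
  spectrum _ _ := ⟨⟨⟩⟩

/-- **The toy holomorphoid** `(X ↪ arith(ℚ)_y)`: the toy normalized arithmeticoid, the one object as the scheme, identity
base-points. [folklore] -/
def toyHolomorphoid : GlobalHolomorphoid toyAnalytic where
  arith := toyNormalized
  X := ⟨⟨⟩⟩
  basePoint _ := 𝟙 _

/-- The signature `GlobalHolomorphoid` ([J-III] Def. 2.1.2 as typed) is inhabited over the toy signatures. [folklore] -/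
theorem globalHolomorphoid_nonempty : Nonempty (GlobalHolomorphoid toyAnalytic) := ⟨toyHolomorphoid⟩

/-- … hence so is the category of holomorphoids `HolCat` (§2.2 as typed). [folklore] -/
theorem holCat_nonempty : Nonempty (HolCat toyAnalytic) := ⟨toyHolomorphoid.toObj⟩

/-- In the toy, the base-point of the toy holomorphoid factors through the base change (Rmk. 2.1.7's predicate is
satisfiable). [folklore] -/
theorem toy_basePointFactors (v : Unit) : toyHolomorphoid.BasePointFactors v := ⟨𝟙 _, rfl⟩

end Summit.ABC.IUTFork.Joshi.ATS3

end
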